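import Summits.AtomisticToContinuum.Crystallization.Theorems.ChartedZeroExcessLayeredLatticeLiouvilleZZL

/-!
# (B′.3c) rider ZZM — THE DICTIONARY, PART II (conclusion): the two-shell frame of a charted clean atom

Lineage `stmt-AtomisticToContinuum-26636` (route ChartedPlanarOrder), lens-2 g80, cone-pin programme (B′) for (L2-S) at record dials.  Rider ZZK placed
the twelve LINK atoms of a charted clean atom `Ψ x` at `Ψ x + a • F (iotaPt i) ± a/16`; rider ZZL proved the index square facts and the CONFUSION
LEMMA.  This file concludes: for every orthogonal pair of link codes `(i, j)` (`ιᵢ · ιⱼ = 0` — the hex–cap pairs; `ιᵢ + ιⱼ` runs over the second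
shell), the charted atom `Ψ (linkPt τ (linkPt τ x i) j)` sits at `Ψ x + a • F (iotaPt i + iotaPt j) ± a/16`, with the SAME scale `a ∈ [9/10, 1]` and
the SAME isometry `F` as the link (`secondShell_frame`).  Mechanism: the genuine second-shell pattern atom `g = f (G ιᵢ/√18 + G ιⱼ/√18)` of `x` and the
charted atom `y` are both common neighbours (within `9/8`) of the two corner atoms `P, Q` of the contact square and of `m = Ψ (linkPt x i)`, as is
`Ψ x`; in the clean pattern of `m` two distinct first-shell vectors have at most two common contacts, and `Ψ x ≠ y, g` — so `y = g`
(`eq_of_common_contacts`, rider ZZL).  No frame or scale of `m` is ever compared with that of `x`.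

0 sorry.  Consumer: the (c1)/(c2) packaging of the pin step ((B′.5)): second-shell MEMBERS of a certificate cell are sites `linkPt (linkPt x i) j` with
`ιᵢ · ιⱼ = 0`, so their atoms lie in the `11/20`-cones of rider ZZE `member_cone_second` around `F (ιᵢ + ιⱼ)/√18`, exactly as the link members lie in
the `5/9`-cones of `member_cone_first` around `F ιᵢ/√18` (rider ZZK `dist_linkPt_frame`).
-/

open scoped RealInnerProductSpace
open Literature.Geometry.DiscreteGeometry (intVec intVec_apply norm_intVec sqNormInt dotInt refPt IsRealization fccInt hcpInt
  fccSecondShellInt hcpSecondShellInt fccTwoShellPattern hcpTwoShellPattern scaledPattern IsTwoShellGoodSet intVec_add)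

namespace Summit.AtomisticToContinuum.Crystallization.Theorems.ChartedZeroExcessLayeredLatticeLiouville

open Summit.AtomisticToContinuum.Crystallization.Theorems.ChartedPlanarOrderRigidityDoor (E3)

/-! ## ZZM-1  The second-shell frame -/

/-- uniform integer-model data of a two-shell pattern: scale `N`, shells `N ∣ 2N`, «positive dot ⇒ equal or contact», «≤ 2 common contacts»,
«orthogonal first-shell sums are pattern vectors». [formal bookkeeping] -/
theorem model_data {Pat : Finset E3} (hP : Pat = fccTwoShellPattern ∨ Pat = hcpTwoShellPattern) :
    ∃ (I : Finset (Fin 3 → ℤ)) (N : ℕ), Pat = scaledPattern I N ∧ 0 < N ∧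
      (∀ s ∈ I, sqNormInt s = N ∨ sqNormInt s = 2 * N) ∧
      (∀ s ∈ I, ∀ t ∈ I, sqNormInt s = N → sqNormInt t = N → 0 < dotInt s t → s = t ∨ 2 * dotInt s t = N) ∧
      (∀ u ∈ I, ∀ v ∈ I, sqNormInt u = N → sqNormInt v = N → u ≠ v →
        (I.filter fun t => sqNormInt t = N ∧ 2 * dotInt t u = N ∧ 2 * dotInt t v = N).card ≤ 2) ∧
      (∀ s ∈ I, ∀ t ∈ I, sqNormInt s = N → sqNormInt t = N → dotInt s t = 0 → s + t ∈ I) := by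
  rcases hP with hP | hP
  · exact ⟨_, 2, by rw [hP]; rfl, two_pos, fcc_sqNorm, fcc_dot_pos, fcc_common_contacts, fcc_orth_sum⟩
  · exact ⟨_, 18, by rw [hP]; rfl, by norm_num, hcp_sqNorm, hcp_dot_pos, hcp_common_contacts, hcp_orth_sum⟩

/-- ★★★ **THE TWO-SHELL FRAME OF A CHARTED CLEAN ATOM.**  Let `Ψ, τ` be a Barlow bond chart of the clean set `S` on `D`, containing `x`, its link and
its two-step sites.  Then ONE scale `a ∈ [9/10, 1]` and ONE linear isometry `F` place the link atoms at `Ψ x + a • F (iotaPt i) ± a/16` AND, for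
every orthogonal pair of codes `(i, j)`, the charted second-shell atom `Ψ (linkPt τ (linkPt τ x i) j)` at `Ψ x + a • F (iotaPt i + iotaPt j) ± a/16`.
[this file, g80] -/
theorem secondShell_frame {S : Set E3} {D : Set (ℤ × ℤ × ℤ)} {Ψ : ℤ × ℤ × ℤ → E3} {τ : ℤ → Bool} {x : ℤ × ℤ × ℤ}
    (hΨ : IsBarlowBondChart S D Ψ τ) (hxD : x ∈ D) (hlD : ∀ i, linkPt τ x i ∈ D) (hl2D : ∀ i j, linkPt τ (linkPt τ x i) j ∈ D)
    (hclean : ∀ p ∈ S, IsTwoShellGoodSet (1 / 16) (9 / 10) 1 S p) :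
    ∃ a : ℝ, 9 / 10 ≤ a ∧ a ≤ 1 ∧ ∃ F : E3 →ₗᵢ[ℝ] E3,
      (∀ i : Fin 12, dist (Ψ (linkPt τ x i)) (Ψ x + a • F (iotaPt (τ (x.1 - 1)) (τ x.1) i)) ≤ 1 / 16 * a) ∧
      ∀ i j : Fin 12, dotInt (iotaTab (τ (x.1 - 1)) (τ x.1) i) (iotaTab (τ (x.1 - 1)) (τ x.1) j) = 0 →
        dist (Ψ (linkPt τ (linkPt τ x i) j)) (Ψ x + a • F (iotaPt (τ (x.1 - 1)) (τ x.1) i + iotaPt (τ (x.1 - 1)) (τ x.1) j)) ≤ 1 / 16 * a := by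
  obtain ⟨a, ha, ha1, A, Pat, f, G, hP, hf, hinj, -, hG⟩ := exists_linkFrame hΨ hxD hlD (hclean _ (hΨ.2.1 hxD))
  have hapos : 0 < a := by linarith
  refine ⟨a, ha, ha1, A.comp G, fun i => ?_, fun i j h0 => ?_⟩
  · obtain ⟨hmem, hfi⟩ := hG i
    rw [← hfi, LinearIsometry.coe_comp, Function.comp_apply]
    exact (hf _ hmem).2
  obtain ⟨I, N, rfl, hN, -, -, -, horth⟩ := model_data hP
  have hN' : (0 : ℝ) < N := by exact_mod_cast hN
  -- metric bookkeeping in the frame of x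
  have hnormA : ∀ v : E3, ‖a • A v‖ = a * ‖v‖ := fun v => by rw [norm_smul, Real.norm_of_nonneg hapos.le, A.norm_map]
  have hideal : ∀ v w : E3, dist (Ψ x + a • A v) (Ψ x + a • A w) = a * ‖v - w‖ := fun v w => by
    rw [dist_eq_norm, add_sub_add_left_eq_sub, ← smul_sub, ← map_sub, hnormA]
  have htri : ∀ {e e' v w : E3}, dist e (Ψ x + a • A v) ≤ 1 / 16 * a → dist e' (Ψ x + a • A w) ≤ 1 / 16 * a →
      dist e e' ≤ 1 / 16 * a + a * ‖v - w‖ + 1 / 16 * a := by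
    intro e e' v w he he'
    calc dist e e' ≤ dist e (Ψ x + a • A v) + dist (Ψ x + a • A v) e' := dist_triangle _ _ _
      _ ≤ 1 / 16 * a + (dist (Ψ x + a • A v) (Ψ x + a • A w) + dist (Ψ x + a • A w) e') := add_le_add he (dist_triangle _ _ _)
      _ ≤ 1 / 16 * a + (a * ‖v - w‖ + 1 / 16 * a) := by rw [hideal, dist_comm (Ψ x + a • A w)]; gcongr
      _ = 1 / 16 * a + a * ‖v - w‖ + 1 / 16 * a := by ring
  have hGι : ∀ k l : Fin 12, ⟪G (iotaPt (τ (x.1 - 1)) (τ x.1) k), G (iotaPt (τ (x.1 - 1)) (τ x.1) l)⟫ =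
      (dotInt (iotaTab (τ (x.1 - 1)) (τ x.1) k) (iotaTab (τ (x.1 - 1)) (τ x.1) l) : ℝ) / 18 := fun k l => by
    have h := inner_scaled (N := 18) (by norm_num) (iotaTab (τ (x.1 - 1)) (τ x.1) k) (iotaTab (τ (x.1 - 1)) (τ x.1) l)
    rw [show ((18 : ℕ) : ℝ) = 18 from by norm_num] at h
    rw [G.inner_map_map, iotaPt, iotaPt, h]
  have hn1 : ∀ k, ‖G (iotaPt (τ (x.1 - 1)) (τ x.1) k)‖ = 1 := fun k => by rw [G.norm_map, norm_iotaPt]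
  -- chart bookkeeping
  have bond : ∀ {u v : ℤ × ℤ × ℤ}, u ∈ D → v ∈ D → BarlowAdj τ u v → Ψ u ≠ Ψ v ∧ dist (Ψ u) (Ψ v) ≤ 9 / 8 := by
    intro u v hu hv hB
    obtain ⟨h0, h1⟩ := (hΨ.2.2 u hu v hv).2 hB
    exact ⟨fun h => by rw [h, dist_self] at h0; exact lt_irrefl _ h0, by linarith⟩
  -- corners and the five atoms
  obtain ⟨p, q, hpq, hpi, hpj, hqi, hqj⟩ := exists_corners _ _ i j h0
  set vi : E3 := G (iotaPt (τ (x.1 - 1)) (τ x.1) i) with hvi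
  set vj : E3 := G (iotaPt (τ (x.1 - 1)) (τ x.1) j) with hvj
  set vp : E3 := G (iotaPt (τ (x.1 - 1)) (τ x.1) p) with hvp
  set vq : E3 := G (iotaPt (τ (x.1 - 1)) (τ x.1) q) with hvq
  have ivj : ⟪vi, vj⟫ = 0 := by rw [hvi, hvj, hGι, h0]; simp
  have ivp : ⟪vi, vp⟫ = 1 / 2 := by rw [hvi, hvp, real_inner_comm, hGι, hpi]; norm_num
  have jvp : ⟪vj, vp⟫ = 1 / 2 := by rw [hvj, hvp, real_inner_comm, hGι, hpj]; norm_num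
  have ivq : ⟪vi, vq⟫ = 1 / 2 := by rw [hvi, hvq, real_inner_comm, hGι, hqi]; norm_num
  have jvq : ⟪vj, vq⟫ = 1 / 2 := by rw [hvj, hvq, real_inner_comm, hGι, hqj]; norm_num
  have nij : ‖vi + vj‖ ^ 2 = 2 := by rw [norm_add_sq_real, ivj, hn1, hn1]; norm_num
  have nijp : ‖vi + vj - vp‖ = 1 := by
    have h : ‖vi + vj - vp‖ ^ 2 = 1 := by rw [norm_sub_sq_real, nij, inner_add_left, ivp, jvp, hn1]; norm_num
    have := norm_nonneg (vi + vj - vp)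
    nlinarith
  have nijq : ‖vi + vj - vq‖ = 1 := by
    have h : ‖vi + vj - vq‖ ^ 2 = 1 := by rw [norm_sub_sq_real, nij, inner_add_left, ivq, jvq, hn1]; norm_num
    have := norm_nonneg (vi + vj - vq)
    nlinarith
  have niji : ‖vi + vj - vi‖ = 1 := by rw [add_sub_cancel_left, hn1]
  -- the genuine second-shell pattern atom g over (i, j)
  have hvij : vi + vj ∈ scaledPattern I N := by
    obtain ⟨si, hsi, esi⟩ := Finset.mem_image.1 (hG i).1
    obtain ⟨sj, hsj, esj⟩ := Finset.mem_image.1 (hG j).1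
    have n_i : sqNormInt si = N := by
      have h := hn1 i
      rw [← esi] at h
      have h2 : ‖(Real.sqrt N)⁻¹ • intVec si‖ ^ 2 = 1 := by rw [h]; norm_num
      rw [norm_scaled_sq hN] at h2
      have h3 : ((sqNormInt si : ℤ) : ℝ) = N := by field_simp at h2; linarith
      exact_mod_cast h3
    have n_j : sqNormInt sj = N := by
      have h := hn1 j
      rw [← esj] at h
      have h2 : ‖(Real.sqrt N)⁻¹ • intVec sj‖ ^ 2 = 1 := by rw [h]; norm_num
      rw [norm_scaled_sq hN] at h2
      have h3 : ((sqNormInt sj : ℤ) : ℝ) = N := by field_simp at h2; linarith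
      exact_mod_cast h3
    have d0 : dotInt si sj = 0 := by
      have h := ivj
      rw [hvi, hvj, ← esi, ← esj, inner_scaled hN] at h
      have h3 : ((dotInt si sj : ℤ) : ℝ) = 0 := by
        rcases div_eq_zero_iff.1 h with h | h
        · exact h
        · exact absurd h hN'.ne'
      exact_mod_cast h3
    have hsum := horth si hsi sj hsj n_i n_j d0
    have : vi + vj = (Real.sqrt N)⁻¹ • intVec (si + sj) := by
      rw [hvi, hvj, ← esi, ← esj, Literature.Geometry.DiscreteGeometry.intVec_add, smul_add]
    rw [this]
    exact Finset.mem_image_of_mem _ hsum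
  set g : E3 := f (vi + vj) with hg
  have hgS : g ∈ S := (hf _ hvij).1
  have hgd : dist g (Ψ x + a • A (vi + vj)) ≤ 1 / 16 * a := (hf _ hvij).2
  -- positions of m, P, Q in the frame of x
  have hmd : dist (Ψ (linkPt τ x i)) (Ψ x + a • A vi) ≤ 1 / 16 * a := by rw [← (hG i).2]; exact (hf _ (hG i).1).2
  have hPd : dist (Ψ (linkPt τ x p)) (Ψ x + a • A vp) ≤ 1 / 16 * a := by rw [← (hG p).2]; exact (hf _ (hG p).1).2
  have hQd : dist (Ψ (linkPt τ x q)) (Ψ x + a • A vq) ≤ 1 / 16 * a := by rw [← (hG q).2]; exact (hf _ (hG q).1).2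
  -- adjacencies in the index
  have axi : BarlowAdj τ x (linkPt τ x i) := barlowAdj_linkPt τ x i
  have axp : BarlowAdj τ x (linkPt τ x p) := barlowAdj_linkPt τ x p
  have axq : BarlowAdj τ x (linkPt τ x q) := barlowAdj_linkPt τ x q
  have aip : BarlowAdj τ (linkPt τ x i) (linkPt τ x p) := (barlowAdj_linkPt_iff τ x i p).2 (linkAdj_of_dot9 _ _ i p hpi)
  have aiq : BarlowAdj τ (linkPt τ x i) (linkPt τ x q) := (barlowAdj_linkPt_iff τ x i q).2 (linkAdj_of_dot9 _ _ i q hqi)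
  have aiz : BarlowAdj τ (linkPt τ x i) (linkPt τ (linkPt τ x i) j) := barlowAdj_linkPt τ _ j
  have apz : BarlowAdj τ (linkPt τ x p) (linkPt τ (linkPt τ x i) j) := barlowAdj_corner τ x h0 hpi hpj
  have aqz : BarlowAdj τ (linkPt τ x q) (linkPt τ (linkPt τ x i) j) := barlowAdj_corner τ x h0 hqi hqj
  -- the clean pattern of m
  obtain ⟨am, ham, -, Am, Pm, fm, hPm, hfm, -, hcovm⟩ := hclean _ (hΨ.2.1 (hlD i))
  obtain ⟨Im, Nm, rfl, hNm, hnormm, hposm, hccm, -⟩ := model_data hPm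
  -- y = g by the confusion lemma
  have hyg : Ψ (linkPt τ (linkPt τ x i) j) = g := by
    refine eq_of_common_contacts (m := Ψ (linkPt τ x i)) (c₀ := Ψ x) (P := Ψ (linkPt τ x p)) (Q := Ψ (linkPt τ x q))
      hNm hnormm hposm hccm ham hfm hcovm (hΨ.2.1 hxD) (hΨ.2.1 (hlD p)) (hΨ.2.1 (hlD q)) (hΨ.2.1 (hl2D i j)) hgS
      (bond hxD (hlD i) axi).1 (bond (hlD i) (hlD p) aip).1.symm (bond (hlD i) (hlD q) aiq).1.symm
      (bond (hlD i) (hl2D i j) aiz).1.symm ?_ ?_ (bond hxD (hlD p) axp).1 (bond hxD (hlD q) axq).1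
      (bond (hlD p) (hl2D i j) apz).1.symm (bond (hlD q) (hl2D i j) aqz).1.symm ?_ ?_ ?_ ?_
      (bond hxD (hlD i) axi).2 ?_ ?_ ?_ ?_ (bond hxD (hlD p) axp).2 (bond hxD (hlD q) axq).2 ?_ ?_ ?_ ?_
    -- g ≠ m
    · intro h
      have h' : vi + vj = vi := hinj (by exact_mod_cast hvij) (by exact_mod_cast (hG i).1) (by rw [(hG i).2]; exact h)
      have : vj = 0 := by simpa using h'
      have h1 := hn1 j
      rw [← hvj, this, norm_zero] at h1
      exact zero_ne_one h1
    -- P ≠ Q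
    · intro h
      exact hpq (linkPt_injective τ x (hΨ.1 (hlD p) (hlD q) h))
    -- g ≠ P
    · intro h
      have h' : vi + vj = vp := hinj (by exact_mod_cast hvij) (by exact_mod_cast (hG p).1) (by rw [(hG p).2]; exact h)
      have h1 := nijp
      rw [h', sub_self, norm_zero] at h1
      exact zero_ne_one h1
    -- g ≠ Q
    · intro h
      have h' : vi + vj = vq := hinj (by exact_mod_cast hvij) (by exact_mod_cast (hG q).1) (by rw [(hG q).2]; exact h)
      have h1 := nijq
      rw [h', sub_self, norm_zero] at h1
      exact zero_ne_one h1
    -- Ψ x ≠ y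
    · intro h
      exact twoStep_ne_self τ x h0 (hΨ.1 (hl2D i j) hxD h.symm)
    -- Ψ x ≠ g
    · intro h
      have h1 : dist (Ψ x) (Ψ x + a • A (vi + vj)) ≤ 1 / 16 * a := by rw [h] at hgd ⊢; exact hgd
      rw [dist_eq_norm, sub_add_cancel_left, norm_neg, hnormA] at h1
      have h2 : 1 ≤ ‖vi + vj‖ := by nlinarith [norm_nonneg (vi + vj), nij]
      nlinarith
    -- dist P m, dist Q m, dist y m, dist g m
    · rw [dist_comm]; exact (bond (hlD i) (hlD p) aip).2
    · rw [dist_comm]; exact (bond (hlD i) (hlD q) aiq).2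
    · rw [dist_comm]; exact (bond (hlD i) (hl2D i j) aiz).2
    · have := htri hgd hmd
      rw [niji] at this
      linarith
    -- dist y P, dist y Q, dist g P, dist g Q
    · rw [dist_comm]; exact (bond (hlD p) (hl2D i j) apz).2
    · rw [dist_comm]; exact (bond (hlD q) (hl2D i j) aqz).2
    · have := htri hgd hPd
      rw [nijp] at this
      linarith
    · have := htri hgd hQd
      rw [nijq] at this
      linarith
  rw [hyg, LinearIsometry.coe_comp, Function.comp_apply, map_add]
  exact hgd

end Summit.AtomisticToContinuum.Crystallization.Theorems.ChartedZeroExcessLayeredLatticeLiouville
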